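import Literature.NumberTheory.Transcendental.KaehlerHodgeDecompositionProofs
import HarnessLib

/-!
# The corrected named fact `mem_charmonicForms_iff` (complex `Δ_d`-harmonic forms form a subspace)

Companion of `Literature/NumberTheory/Transcendental/KaehlerHodge.lean` (C12), serving its named fact
`Literature.NumberTheory.Transcendental.mem_charmonicForms_iff`
("`α ∈ charmonicForms o h ↔ IsCHarmonicForm o h α`": the complex `Δ_d`-harmonic `k`-forms
`{α smooth | Δ_d α = 0}` already form a `ℂ`-subspace, so the `Submodule.span` in the definition of
`charmonicForms` adds nothing). Source: Warner, *Foundations of Differentiable Manifolds and Lie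
Groups*, GTM 94, 6.1 (p. 220: "The Laplace–Beltrami operator `Δ` … `Δ = δd + dδ`, and is a linear
operator on `E^p(M)` for each `p`") and Def. 6.7 (p. 222: "`H^p = {ω ∈ E^p(M) : Δω = 0}`"), for the
complexified Laplacian (Voisin (2002), §5.1.4 and Thm. 5.23, §5.3.1: "the space of complex-valued
harmonic forms"; Ch. 6, p. 137: "the three Laplacians `Δ_d`, `Δ_∂`, `Δ_∂̄` all act on the complex
differential forms of `X`").

## The named fact is mis-stated (dropped instances); what is vendored instead

`def mem_charmonicForms_iff : Prop` is declared in `section Smooth` of `KaehlerHodge.lean`, whose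
instance variables `[IsManifold 𝓘(ℂ, E) ω M]`, `[IsManifold 𝓘(ℝ, E) ∞ M]`,
`[IsContinuousRiemannianBundle E (fun x ↦ TangentSpace 𝓘(ℝ, E) x)]`,
`[IsContMDiffRiemannianBundle 𝓘(ℝ, E) ∞ E (fun x ↦ TangentSpace 𝓘(ℝ, E) x)]` are **not used by its
body**; a `def` abstracts only the section variables it mentions, so none of them is a hypothesis
of the fact (`#check @mem_charmonicForms_iff`: the only assumption on the metric is
`[RiemannianBundle (fun x ↦ TangentSpace 𝓘(ℝ, E) x)]`, Mathlib's fibrewise inner product of *no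
regularity in the base point*). In Warner (4.10, p. 149: "`m ↦ ⟨X, Y⟩_m` is a smooth function on `M`
whenever `X` and `Y` are smooth vector fields") and Voisin the metric is `C^∞`. Over rough metrics
the statement is false, exactly as for its real sibling `Literature.Geometry.Kaehler.mem_harmonicForms_iff`,
which has the same defect and is formally **refuted** in
`Literature/Geometry/Kaehler/RiemannianHodgeRoughMetric.lean`
(`not_forall_mem_harmonicForms_iff`: on `ℝ²` with `g = a dx² + a⁻¹ dy²`, `a = exp (x · 𝟙_ℚ(y))`
differentiable nowhere, `vol = dx ∧ dy` is smooth, the smooth functions `y + x²/2` and `-y` are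
"harmonic" because `⋆d` of each is differentiable nowhere and the `fderivWithin`-based `mextDeriv`
returns the junk value `0`, while their sum `x²/2` has `Δ(x²/2)(0) ≠ 0`). Since the complexified
Laplacian extends the real one unconditionally (`cHodgeLaplacian_ofReal_holds`:
`Δ_d (β ⊗ 1) = (Δβ) ⊗ 1`), the same metric, rebuilt on `E = M = ℂ`, violates the complex statement
(`(x²/2) ⊗ 1 ∈ charmonicForms` but is not `IsCHarmonicForm`; a formal refutation
`not_forall_mem_charmonicForms_iff` is proposed in the companion file `KaehlerHodgeRoughMetric.lean`);
hence `theorem mem_charmonicForms_iff_holds : mem_charmonicForms_iff` (universally closed over all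
such metrics) cannot be proved, and following D-0014 the original `def` is left untouched (it has no
dependents).

What is true for every *smooth* metric is already in the tree: `Δ_d` is `ℂ`-linear on smooth forms
and the over-general fact holds in the presence of the intended instances —
`cHodgeLaplacian_add`, `cHodgeLaplacian_smul`, `IsCHarmonicForm.add/.smul`, `isCHarmonicForm_zero`
and the bridge `mem_charmonicForms_iff_of_contMDiffMetric : mem_charmonicForms_iff o` of
`KaehlerHodgeDecompositionProofs.lean` (built on `IsSmoothForm.cHodgeStar` of
`KaehlerHodgeSmoothProofs.lean`; Warner's one line "`Δ` is a linear operator on `E^p(M)`", then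
`Submodule.span_induction`). This file adds:

* `coe_charmonicForms_eq` — under the intended instances the carrier of `charmonicForms o h` *is*
  the set of `Δ_d`-harmonic forms;
* the **corrected closed statement** `mem_charmonicForms_iff_of_isContMDiffRiemannianBundle : Prop`
  (intended hypotheses bound inside, in the format of the sibling corrected facts
  `isSmoothForm_hodgeStar_of_isContMDiffRiemannianBundle`,
  `mcoderiv_mcoderiv_of_isContMDiffRiemannianBundle`,
  `isSmoothForm_cHodgeStar_of_isContMDiffRiemannianBundle`,
  `mem_charmonicForms_iff_re_im_of_isContMDiffRiemannianBundle`) and its discharge `…_holds`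
  (no new unproved fact is introduced).

The complex structure of `M` (`IsManifold 𝓘(ℂ, E) ω M`) and `IsContinuousRiemannianBundle` play no
role and are not assumed.

## References

* F. W. Warner, *Foundations of Differentiable Manifolds and Lie Groups*, GTM 94, Springer (1983):
  6.1, p. 220; Def. 6.7, p. 222; 4.10, pp. 149–150.
* C. Voisin, *Hodge Theory and Complex Algebraic Geometry I*, CUP (2002): §5.1.4 (Laplacians),
  Def. 5.14, Thm. 5.23 (§5.3.1), Ch. 6 introduction (p. 137).
-/

noncomputable section

open scoped Manifold ContDiff Topology
open Bundle Module Set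

namespace Literature.NumberTheory.Transcendental

open Literature.Geometry.Kaehler

section Smooth

variable {E : Type*} [NormedAddCommGroup E] [NormedSpace ℂ E] [FiniteDimensional ℂ E]
  {n : ℕ} [Fact (finrank ℝ E = n)]
  {M : Type*} [TopologicalSpace M] [ChartedSpace E M] [IsManifold 𝓘(ℝ, E) ∞ M]
  [RiemannianBundle (fun x : M ↦ TangentSpace 𝓘(ℝ, E) x)]
  [IsContMDiffRiemannianBundle 𝓘(ℝ, E) ∞ E (fun x : M ↦ TangentSpace 𝓘(ℝ, E) x)] {k m : ℕ}
  (o : (x : M) → Orientation ℝ (TangentSpace 𝓘(ℝ, E) x) (Fin n))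

/-- Under the intended instances (`C^∞` manifold, `C^∞` metric, orientation family with smooth
volume form) the carrier of `charmonicForms o h` *is* the set of `Δ_d`-harmonic forms
(`mem_charmonicForms_iff_of_contMDiffMetric`, pointwise). Warner (1983), Def. 6.7.
[cite: WarnerGTM94, Def. 6.7, p. 222] -/
theorem coe_charmonicForms_eq (ho : IsSmoothForm (riemannianVolumeForm o)) (h : k + m = n) :
    (charmonicForms o h : Set (MForm 𝓘(ℝ, E) M ℂ k)) = {α | IsCHarmonicForm o h α} :=
  Set.ext fun α ↦ mem_charmonicForms_iff_of_contMDiffMetric o ho h α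

end Smooth

/-! ### The corrected named fact -/

/-- **Corrected statement of the named fact
`Literature.NumberTheory.Transcendental.mem_charmonicForms_iff`** (`KaehlerHodge.lean`). On a
`C^∞` manifold `M` modelled on a finite-dimensional complex normed space `E`
(`[IsManifold 𝓘(ℝ, E) ∞ M]`) with a `C^∞` Riemannian metric
(`[IsContMDiffRiemannianBundle 𝓘(ℝ, E) ∞ E (fun x ↦ TangentSpace 𝓘(ℝ, E) x)]`) and an orientation
family `o` with smooth volume form (`(M, o)` oriented), a complex `k`-form lies in the `ℂ`-span
`charmonicForms o h` of the `Δ_d`-harmonic forms iff it is itself `Δ_d`-harmonic (smooth with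
`Δ_d α = 0`): the harmonic forms `H^p = {ω ∈ E^p(M) : Δω = 0}` form a linear subspace because
"`Δ = δd + dδ` … is a linear operator on `E^p(M)`" (Warner, GTM 94, 6.1, p. 220, and Def. 6.7,
p. 222), here for the complexified Laplacian acting on complex-valued forms (Voisin (2002), §5.1.4,
Thm. 5.23).

Discrepancy with the original: `def mem_charmonicForms_iff` is declared in a section whose instance
variables `[IsManifold 𝓘(ℂ, E) ω M]`, `[IsManifold 𝓘(ℝ, E) ∞ M]`,
`[IsContinuousRiemannianBundle E (TangentSpace 𝓘(ℝ, E))]`,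
`[IsContMDiffRiemannianBundle 𝓘(ℝ, E) ∞ E (TangentSpace 𝓘(ℝ, E))]` are *not used in its body*, hence
are not part of the definition: as declared it quantifies over arbitrary charted spaces and
arbitrary fibrewise (possibly discontinuous) families of inner products (`Bundle.RiemannianBundle`),
which is stronger than the source (Warner, 4.10, p. 149: the metric is smooth) and false in that
generality — the rough metric `a dx² + a⁻¹ dy²` on `ℝ²` of
`Literature/Geometry/Kaehler/RiemannianHodgeRoughMetric.lean` refutes the real sibling
`mem_harmonicForms_iff` (`not_forall_mem_harmonicForms_iff`), and since `Δ_d (β ⊗ 1) = (Δβ) ⊗ 1`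
unconditionally (`cHodgeLaplacian_ofReal_holds`) the complexified statement fails on the same metric
rebuilt on `ℂ` (formal refutation proposed in the companion file `KaehlerHodgeRoughMetric.lean`).
Here the two hypotheses of Warner's setting are bound *inside* a closed statement (the complex
structure `IsManifold 𝓘(ℂ, E) ω M` and `IsContinuousRiemannianBundle` are not needed). Discharged by
`mem_charmonicForms_iff_of_isContMDiffRiemannianBundle_holds`; the usable forms are
`cHodgeLaplacian_add` / `IsCHarmonicForm.add` and the bridge `mem_charmonicForms_iff_of_contMDiffMetric`
(`KaehlerHodgeDecompositionProofs.lean`). [cite: WarnerGTM94, 6.1 (p. 220) and Def. 6.7 (p. 222)] -/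
def mem_charmonicForms_iff_of_isContMDiffRiemannianBundle : Prop :=
  ∀ {E : Type*} [NormedAddCommGroup E] [NormedSpace ℂ E] [FiniteDimensional ℂ E] {n : ℕ}
    [Fact (finrank ℝ E = n)] {M : Type*} [TopologicalSpace M] [ChartedSpace E M]
    [IsManifold 𝓘(ℝ, E) ∞ M] [RiemannianBundle (fun x : M ↦ TangentSpace 𝓘(ℝ, E) x)]
    [IsContMDiffRiemannianBundle 𝓘(ℝ, E) ∞ E (fun x : M ↦ TangentSpace 𝓘(ℝ, E) x)] {k m : ℕ}
    (o : (x : M) → Orientation ℝ (TangentSpace 𝓘(ℝ, E) x) (Fin n)),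
    IsSmoothForm (riemannianVolumeForm o) → ∀ (h : k + m = n) (α : MForm 𝓘(ℝ, E) M ℂ k),
      α ∈ charmonicForms o h ↔ IsCHarmonicForm o h α

/-- **Discharge of `mem_charmonicForms_iff_of_isContMDiffRiemannianBundle`** (the corrected form of
the named fact `mem_charmonicForms_iff`): immediate from the bridge
`mem_charmonicForms_iff_of_contMDiffMetric` of `KaehlerHodgeDecompositionProofs.lean` (`Δ_d` is
`ℂ`-linear on smooth forms for a smooth metric; span induction). Warner, GTM 94, 6.1 and Def. 6.7,
pp. 220–222. [cite: WarnerGTM94, 6.1 (p. 220) and Def. 6.7 (p. 222)] -/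
theorem mem_charmonicForms_iff_of_isContMDiffRiemannianBundle_holds :
    mem_charmonicForms_iff_of_isContMDiffRiemannianBundle :=
  fun o ho h α ↦ mem_charmonicForms_iff_of_contMDiffMetric o ho h α

end Literature.NumberTheory.Transcendental
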